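import Summits.QuantumFields.YangMills.Theses.SamplerStability

/-!
# Route `SamplerStability` (planner seat ym-idea-5 g9), support item `GapRateToWaist` (stmt-QuantumFields-28102): the K-uniform heat-bath
# Poincaré inequality and the square-summable specification (Hellinger) rate give the WAIST — total-variation summability of consecutive
# renormalised unit laws, in dual bounded-measurable form

Width seat ym-line-sfw-p2-w2 g20 (cell `ym-idea-1`, free hands).  With `WaistToLeaf` (p642520) and the glue (p642525) this completes the kernel-checked
reduction `StabilityKernel ⇐ UnitSamplerGap ∧ SpecificationRate` of the line (critic #109 price 2).  Rung R3 is a RECORD rung: no summit, no mass gap is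
proved; the two cruxes stay open.

THE ARGUMENT (pure measure theory).  Fix `K ≥ max K₁ K₂`, `ν = ν_K`, `ν' = ν_{K+1} = h·ν` (`h = h_K ≥ 0` measurable), `s = √h`, `A = ∫ s dν`.
* `∫ h dν = ν'(univ) = 1`, so `s ∈ L²(ν)` with `∫ s² dν = 1`.
* Poincaré at `g = s`: `1 − A² = Var_ν(s) ≤ C·Σ_e (∫ h dν − ∫ (E_ν[s | 𝓕_{≠e}])² dν) ≤ C·ι_K²` (the specification rate).
* For measurable `|f| ≤ 1`: `|∫ f dν' − ∫ f dν| = |∫ (h − 1) f dν| ≤ ∫ |h − 1| dν = ∫ |s − 1|(s + 1) dν ≤ ‖s − 1‖₂ ‖s + 1‖₂ = √((2 − 2A)(2 + 2A)) = 2√(1 − A²)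
  ≤ 2√C·|ι_K|` (Cauchy–Schwarz), and `Σ_K 2√C|ι_K| < ∞`.

References: D. Bakry, I. Gentil, M. Ledoux, *Analysis and Geometry of Markov Diffusion Operators* (2014) §4.2 (Poincaré inequality, variance of
densities); L. Le Cam (Hellinger affinity vs total variation), cf. A. Tsybakov, *Introduction to Nonparametric Estimation* (2009) Lemma 2.3.
-/

set_option autoImplicit false

noncomputable section

open MeasureTheory Filter Topology
open scoped ENNReal

namespace Summit.QuantumFields.YangMills.Theorems.SamplerStabilityWaist

open Literature.MathematicalPhysics.QuantumFieldTheory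
open Literature.MathematicalPhysics.QuantumFieldTheory.Balaban1983to89
open Literature.MathematicalPhysics.QuantumFieldTheory.Balaban1983to89.T3ContinuumYM3Torus
open Literature.MathematicalPhysics.QuantumFieldTheory.Balaban1983to89.T3ThresholdRemoval (isProbabilityMeasure_unitLaw)

/-! ## §1 Hellinger affinity controls total variation (one probability space, one density) -/

/-- **AFFINITY ⇒ TOTAL VARIATION (dual form)**: on a probability space `(X, ν)`, a measurable density `h ≥ 0` with `∫ h dν = 1` and
`s = √h`, `A = ∫ s dν`: for every measurable `|f| ≤ 1`, `|∫ h·f dν − ∫ f dν| ≤ 2·√(1 − A²)`. [folklore] -/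
theorem abs_integral_density_sub_le {X : Type*} [MeasurableSpace X] (ν : Measure X) [IsProbabilityMeasure ν]
    {h : X → ℝ} (hhm : Measurable h) (hh0 : ∀ x, 0 ≤ h x) (hone : ∫ x, h x ∂ν = 1)
    {f : X → ℝ} (hfm : Measurable f) (hf1 : ∀ x, |f x| ≤ 1) :
    |(∫ x, h x * f x ∂ν) - ∫ x, f x ∂ν| ≤ 2 * Real.sqrt (1 - (∫ x, Real.sqrt (h x) ∂ν) ^ 2) := by
  -- integrability bookkeeping
  have hint : Integrable h ν := by
    refine ⟨hhm.aestronglyMeasurable, ?_⟩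
    by_contra hnot
    have : ∫ x, h x ∂ν = 0 := integral_undef (fun hi => hnot hi.2)
    rw [this] at hone; exact zero_ne_one hone
  set s : X → ℝ := fun x => Real.sqrt (h x) with hsdef
  have hsm : Measurable s := hhm.sqrt
  have hs0 : ∀ x, 0 ≤ s x := fun x => Real.sqrt_nonneg _
  have hs2 : ∀ x, s x ^ 2 = h x := fun x => Real.sq_sqrt (hh0 x)
  have hint2 : Integrable (fun x => s x ^ 2) ν := by simp only [hs2]; exact hint
  have hsL2 : MemLp s 2 ν := (memLp_two_iff_integrable_sq hsm.aestronglyMeasurable).mpr hint2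
  have hsint : Integrable s ν := hsL2.integrable one_le_two
  have hfint : Integrable f ν :=
    (integrable_const (1 : ℝ)).mono' hfm.aestronglyMeasurable (Eventually.of_forall fun x => by simpa using hf1 x)
  have hhf : Integrable (fun x => h x * f x) ν := by
    refine hint.mono' (hhm.mul hfm).aestronglyMeasurable (Eventually.of_forall fun x => ?_)
    rw [Real.norm_eq_abs, abs_mul, abs_of_nonneg (hh0 x)]
    exact mul_le_of_le_one_right (hh0 x) (hf1 x)
  set A : ℝ := ∫ x, s x ∂ν with hAdef
  -- `|∫ h f − ∫ f| ≤ ∫ |h − 1|`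
  have h1 : |(∫ x, h x * f x ∂ν) - ∫ x, f x ∂ν| ≤ ∫ x, |h x - 1| ∂ν := by
    rw [← integral_sub hhf hfint]
    refine (abs_integral_le_integral_abs).trans (integral_mono_of_nonneg (Eventually.of_forall fun x => abs_nonneg _)
      ((hint.sub (integrable_const 1)).abs) (Eventually.of_forall fun x => ?_))
    show |h x * f x - f x| ≤ |h x - 1|
    rw [show h x * f x - f x = (h x - 1) * f x by ring, abs_mul]
    exact mul_le_of_le_one_right (abs_nonneg _) (hf1 x)
  -- `∫ |h − 1| = ∫ |s − 1|·(s + 1) ≤ ‖s − 1‖₂ ‖s + 1‖₂`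
  have hfac : ∀ x, |h x - 1| = |s x - 1| * (s x + 1) := fun x => by
    have hx1 : 0 ≤ s x + 1 := by linarith [hs0 x]
    rw [← hs2 x, show s x ^ 2 - 1 = (s x - 1) * (s x + 1) by ring, abs_mul, abs_of_nonneg hx1]
  have hL2a : MemLp (fun x => |s x - 1|) (ENNReal.ofReal 2) ν := by
    rw [show ENNReal.ofReal 2 = 2 by norm_num]; exact (hsL2.sub (memLp_const 1)).abs
  have hL2b : MemLp (fun x => s x + 1) (ENNReal.ofReal 2) ν := by
    rw [show ENNReal.ofReal 2 = 2 by norm_num]; exact hsL2.add (memLp_const 1)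
  have hCS := integral_mul_le_Lp_mul_Lq_of_nonneg Real.HolderConjugate.two_two
    (Eventually.of_forall fun x => abs_nonneg (s x - 1))
    (Eventually.of_forall fun x => show (0 : X → ℝ) x ≤ s x + 1 by simp only [Pi.zero_apply]; linarith [hs0 x]) hL2a hL2b
  have hp2 : ∀ x, |s x - 1| ^ (2 : ℝ) = (s x - 1) ^ 2 := fun x => by rw [Real.rpow_two, sq_abs]
  have hq2 : ∀ x, (s x + 1) ^ (2 : ℝ) = (s x + 1) ^ 2 := fun x => by rw [Real.rpow_two]
  simp_rw [hp2, hq2] at hCS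
  rw [← Real.sqrt_eq_rpow, ← Real.sqrt_eq_rpow] at hCS
  -- the two second moments: `∫ (s−1)² = 2 − 2A`, `∫ (s+1)² = 2 + 2A`
  have hI1 : ∫ x, (s x - 1) ^ 2 ∂ν = 2 - 2 * A := by
    have he : (fun x => (s x - 1) ^ 2) = fun x => (s x ^ 2 - 2 * s x) + 1 := funext fun x => by ring
    have hi : Integrable (fun x => s x ^ 2 - 2 * s x) ν := hint2.sub (hsint.const_mul 2)
    rw [he, integral_add hi (integrable_const 1), integral_sub hint2 (hsint.const_mul 2), integral_const_mul]
    simp only [hs2, hone, integral_const, probReal_univ, smul_eq_mul, one_mul]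
    rw [hAdef]; ring
  have hI2 : ∫ x, (s x + 1) ^ 2 ∂ν = 2 + 2 * A := by
    have he : (fun x => (s x + 1) ^ 2) = fun x => (s x ^ 2 + 2 * s x) + 1 := funext fun x => by ring
    have hi : Integrable (fun x => s x ^ 2 + 2 * s x) ν := hint2.add (hsint.const_mul 2)
    rw [he, integral_add hi (integrable_const 1), integral_add hint2 (hsint.const_mul 2), integral_const_mul]
    simp only [hs2, hone, integral_const, probReal_univ, smul_eq_mul, one_mul]
    rw [hAdef]; ring
  rw [hI1, hI2] at hCS
  have hX0 : 0 ≤ 2 - 2 * A := by rw [← hI1]; exact integral_nonneg fun x => sq_nonneg _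
  have hprod : Real.sqrt (2 - 2 * A) * Real.sqrt (2 + 2 * A) = 2 * Real.sqrt (1 - A ^ 2) := by
    rw [← Real.sqrt_mul hX0, show (2 - 2 * A) * (2 + 2 * A) = 2 ^ 2 * (1 - A ^ 2) by ring,
      Real.sqrt_mul (by norm_num) , Real.sqrt_sq (by norm_num)]
  calc |(∫ x, h x * f x ∂ν) - ∫ x, f x ∂ν| ≤ ∫ x, |h x - 1| ∂ν := h1
    _ = ∫ x, |s x - 1| * (s x + 1) ∂ν := by simp only [hfac]
    _ ≤ Real.sqrt (2 - 2 * A) * Real.sqrt (2 + 2 * A) := hCS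
    _ = 2 * Real.sqrt (1 - A ^ 2) := hprod

/-! ## §2 The support item -/

/-- ★★ **`GapRateToWaist` HOLDS** (support item stmt-QuantumFields-28102 of route `SamplerStability`): the K-uniform heat-bath Poincaré inequality
(body of `UnitSamplerGap`) at `g := √h_K` and the square-summable specification rate (body of `SpecificationRate`) give `Var_{ν_K}(√h_K) = 1 − A_K² ≤ C·ι_K²`,
hence (§1) the WAIST with `d_K = 2√C·|ι_K|`, summable. [folklore] -/
theorem gapRateToWaist_proof : Summit.QuantumFields.YangMills.Theses.SamplerStability.GapRateToWaist := by
  unfold Summit.QuantumFields.YangMills.Theses.SamplerStability.GapRateToWaist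
  intro F γ hγ hG hR
  obtain ⟨C, K₁, hC, hP⟩ := hG
  obtain ⟨K₂, h, ι, hι, hR⟩ := hR
  refine ⟨max K₁ K₂, fun K => 2 * Real.sqrt C * |ι K|, (hι.abs.mul_left (2 * Real.sqrt C)), fun K hK f hfm hf1 => ?_⟩
  have hK₁ : K₁ ≤ K := (le_max_left _ _).trans hK
  have hK₂ : K₂ ≤ K := (le_max_right _ _).trans hK
  have hP' := hP K hK₁
  obtain ⟨hhm, hh0, hν', hrate⟩ := hR K hK₂
  clear hP hR
  set ν := F.unitLaw (ExpMeanLog.expMeanLogSU : LoopAverage (Matrix.specialUnitaryGroup (Fin 2) ℂ))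
    T4ApexTwoLevel.measurableE_expMeanLogSU γ K with hνdef
  set ν' := F.unitLaw (ExpMeanLog.expMeanLogSU : LoopAverage (Matrix.specialUnitaryGroup (Fin 2) ℂ))
    T4ApexTwoLevel.measurableE_expMeanLogSU γ (K + 1) with hν'def
  haveI : IsProbabilityMeasure ν := isProbabilityMeasure_unitLaw T4ApexTwoLevel.measurableE_expMeanLogSU hγ.le K
  haveI : IsProbabilityMeasure ν' := isProbabilityMeasure_unitLaw T4ApexTwoLevel.measurableE_expMeanLogSU hγ.le (K + 1)
  -- `∫ h dν = 1`
  have hofm : Measurable fun V => ENNReal.ofReal (h K V) := ENNReal.measurable_ofReal.comp hhm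
  have hlin : ∫⁻ V, ENNReal.ofReal (h K V) ∂ν = 1 := by
    have huniv : ν' Set.univ = 1 := measure_univ
    rw [hν', withDensity_apply _ MeasurableSet.univ, Measure.restrict_univ] at huniv
    exact huniv
  have hone : ∫ V, h K V ∂ν = 1 := by
    rw [integral_eq_lintegral_of_nonneg_ae (Eventually.of_forall hh0) hhm.aestronglyMeasurable, hlin, ENNReal.toReal_one]
  have hint : Integrable (h K) ν := by
    refine ⟨hhm.aestronglyMeasurable, ?_⟩
    rw [hasFiniteIntegral_iff_ofReal (Eventually.of_forall hh0), hlin]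
    exact ENNReal.one_lt_top
  -- `∫ φ dν' = ∫ h·φ dν`
  have htrans : ∫ V, f V ∂ν' = ∫ V, h K V * f V ∂ν := by
    rw [hν', integral_withDensity_eq_integral_toReal_smul hofm (Eventually.of_forall fun _ => ENNReal.ofReal_lt_top)]
    refine integral_congr_ae (Eventually.of_forall fun V => ?_)
    show (ENNReal.ofReal (h K V)).toReal • f V = h K V * f V
    rw [ENNReal.toReal_ofReal (hh0 V), smul_eq_mul]
  -- Poincaré at `s = √h`
  set s : GaugeField (F.P 0) 0 (Matrix.specialUnitaryGroup (Fin 2) ℂ) → ℝ := fun W => Real.sqrt (h K W) with hsdef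
  have hsm : Measurable s := hhm.sqrt
  have hs2 : ∀ V, s V ^ 2 = h K V := fun V => Real.sq_sqrt (hh0 V)
  have hint2 : Integrable (fun V => s V ^ 2) ν := by simp only [hs2]; exact hint
  have hsL2 : MemLp s 2 ν := (memLp_two_iff_integrable_sq hsm.aestronglyMeasurable).mpr hint2
  have hPs := hP' s hsL2
  have hs2i : ∫ V, s V ^ 2 ∂ν = 1 := by simp only [hs2]; exact hone
  rw [hs2i] at hPs
  rw [hone] at hrate
  have hvar : 1 - (∫ V, s V ∂ν) ^ 2 ≤ C * ι K ^ 2 := hPs.trans (mul_le_mul_of_nonneg_left hrate hC.le)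
  -- total variation in dual form
  rw [htrans]
  refine (abs_integral_density_sub_le ν hhm hh0 hone hfm hf1).trans ?_
  have hsq : Real.sqrt (1 - (∫ V, Real.sqrt (h K V) ∂ν) ^ 2) ≤ Real.sqrt C * |ι K| := by
    rw [← Real.sqrt_sq_eq_abs, ← Real.sqrt_mul hC.le]
    exact Real.sqrt_le_sqrt hvar
  nlinarith [hsq, Real.sqrt_nonneg (1 - (∫ V, Real.sqrt (h K V) ∂ν) ^ 2)]

end Summit.QuantumFields.YangMills.Theorems.SamplerStabilityWaist

end
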